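import Summits.QuantumFields.YangMills.Theorems.ConvexGribovBodyPoincareToGapTimeShift
import Summits.QuantumFields.YangMills.Theorems.ConvexGribovBodyPoincareToGapRetentionOfSmoothWitness
import Summits.QuantumFields.YangMills.Theorems.ConvexGribovBodyPoincareToGapProjectionOfRetention

/-!
# One-slice projection bound from the slice Poincaré hypothesis and a smooth witness
(crux `ConvexGribovBody.PoincareToGap`, line `Sketch`, reshape 4 composition; lead c3)

Torus `(ℤ/(2S+1))⁴`, Wilson state `μ = wilsonMeasure r.ρ β`, `X_s` = the spatial links based at time `s`,
`P_D := μ[· | cylinderEvents D]`, `dir_s` = the crux's single-link Dirichlet form moved to slice `s`.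

`oneSliceProjectionBound_of_smoothWitness`: for fixed `G, r, β > 0, κ, S₀`, IF
* (HYP) the antecedent of `ConvexGribovBody.PoincareToGap` holds from `S₀` on (slice Poincaré with constant `κ` for
  gauge-invariant link-Lipschitz functions of the time-zero spatial links, verbatim `let`-free body), and
* (SW, SMOOTH WITNESS) there are `C > 0` and `S₁` such that on every torus `S ≥ S₁`, every slice `s` and every bounded
  measurable gauge-invariant `F` reading `X_s` there is an admissible `F₁` (measurable, bounded, gauge-invariant, reading
  `X_s`, link-Lipschitz) with `dir_s(F₁)/β + ∫ (F − F₁)² ≤ C ∫ (F − P_{X_sᶜ} F)²`,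
THEN the ONE-SLICE PROJECTION BOUND (child `OneSliceProjectionBound` / PB1 of the line, signature verbatim) holds:
`∃ θ₁ ∈ [0,1), S₁', ∀ S ≥ S₁', s, h` bounded measurable gauge-invariant reading `X_sᶜ`: `Var(P_{X_s} h) ≤ θ₁ Var h`.

Proof: `K := max (2 max(κβ,1) C) 1`, `θ₁ := 1 − 1/K`; for `S ≥ max S₀ S₁`, the hypothesis moved to slice `s`
(`stub_sliceHypothesis_timeShift`, p155704) and SW give one-slice retention `Var F ≤ K ‖F − P_{X_sᶜ}F‖²`
(`stub_retention_of_smoothWitness`, p156157), and retention gives the projection bound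
(`stub_oneSliceProjectionBound_of_retention`, p156414: the landed duality with the link sets exchanged).  SW is the
hypothesis-free, `β`-local heart of PB1 (the typed K-functional form of the "smooth witness for slow modes of the
one-step kernel"); this file records that nothing else is needed.

References: P. Diaconis, L. Saloff-Coste, Ann. Appl. Probab. 3 (1993) 696–730 (comparison of Dirichlet forms);
F. Martinelli, LNM 1717 (1999), §3.
-/

noncomputable section

open scoped BigOperators Topology
open MeasureTheory ProbabilityTheory Filter
open Literature.MathematicalPhysics.QuantumFieldTheory Literature.MathematicalPhysics.QuantumLattice

namespace Summit.QuantumFields.YangMills.Theorems.PoincareToGap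

/-- **PB1 ⟸ HYP ∧ SW.**  The slice Poincaré hypothesis of `ConvexGribovBody.PoincareToGap` (from `S₀` on, constant `κ`)
together with a smooth admissible witness for every bounded gauge-invariant one-slice function (constant `C`, from `S₁` on)
gives the one-slice projection bound `Var(E_μ[h | X_s]) ≤ θ₁ Var h`, `θ₁ = 1 − 1/max(2 max(κβ,1) C, 1) < 1`, for every
bounded measurable gauge-invariant `h` reading links other than `X_s`, on all tori `S ≥ max S₀ S₁`. -/
theorem oneSliceProjectionBound_of_smoothWitness :
    ∀ (G : Type) [Group G] [TopologicalSpace G] [IsTopologicalGroup G] [CompactSpace G]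
      [MeasurableSpace G] [BorelSpace G] (r : LatticeRep G) (β : ℝ), 0 < β → ∀ (κ : ℝ) (S₀ : ℕ),
    (∀ S : ℕ, S₀ ≤ S → ∀ f : GaugeConfig 4 (2 * S + 1) G → ℝ, IsGaugeInvariant f →
      (∀ U V : GaugeConfig 4 (2 * S + 1) G,
        (∀ e : Edge 4 (2 * S + 1), e.1 0 = 0 → e.2 ≠ 0 → U e = V e) → f U = f V) →
      (∃ K : ℝ, ∀ U V : GaugeConfig 4 (2 * S + 1) G,
        |f U - f V| ≤ K * ∑ e, Real.sqrt (∑ a, ∑ b, ‖(r.ρ (U e) - r.ρ (V e)) a b‖ ^ 2)) →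
      ∫ U, (f U - ∫ V, f V ∂(wilsonMeasure r.ρ β : Measure (GaugeConfig 4 (2 * S + 1) G))) ^ 2
          ∂(wilsonMeasure r.ρ β : Measure (GaugeConfig 4 (2 * S + 1) G)) ≤
        κ * ∑ e : Edge 4 (2 * S + 1), (if e.1 0 = 0 ∧ e.2 ≠ 0 then
          ∫ U, (Filter.limsup (fun g : G => |f (Function.update U e g) - f U| /
              Real.sqrt (∑ a, ∑ b, ‖(r.ρ g - r.ρ (U e)) a b‖ ^ 2)) (𝓝[≠] (U e))) ^ 2
            ∂(wilsonMeasure r.ρ β : Measure (GaugeConfig 4 (2 * S + 1) G)) else 0)) →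
    (∃ C : ℝ, 0 < C ∧ ∃ S₁ : ℕ, ∀ S : ℕ, S₁ ≤ S →
      ∀ μ : Measure (GaugeConfig 4 (2 * S + 1) G),
        μ = (wilsonMeasure r.ρ β : Measure (GaugeConfig 4 (2 * S + 1) G)) →
      ∀ (s : ZMod (2 * S + 1)) (F : GaugeConfig 4 (2 * S + 1) G → ℝ), Measurable F →
        (∃ M : ℝ, ∀ U, |F U| ≤ M) → IsGaugeInvariant F →
        DependsOn F {e : Edge 4 (2 * S + 1) | (e.1 0 - s).val = 0 ∧ e.2 ≠ 0} →
      ∃ F₁ : GaugeConfig 4 (2 * S + 1) G → ℝ, Measurable F₁ ∧ (∃ M : ℝ, ∀ U, |F₁ U| ≤ M) ∧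
        IsGaugeInvariant F₁ ∧
        (∀ U V : GaugeConfig 4 (2 * S + 1) G,
          (∀ e : Edge 4 (2 * S + 1), (e.1 0 - s).val = 0 → e.2 ≠ 0 → U e = V e) → F₁ U = F₁ V) ∧
        (∃ K : ℝ, ∀ U V : GaugeConfig 4 (2 * S + 1) G,
          |F₁ U - F₁ V| ≤ K * ∑ e, Real.sqrt (∑ a, ∑ b, ‖(r.ρ (U e) - r.ρ (V e)) a b‖ ^ 2)) ∧
        (∑ e : Edge 4 (2 * S + 1), (if (e.1 0 - s).val = 0 ∧ e.2 ≠ 0 then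
            ∫ U, (Filter.limsup (fun g : G => |F₁ (Function.update U e g) - F₁ U| /
                Real.sqrt (∑ a, ∑ b, ‖(r.ρ g - r.ρ (U e)) a b‖ ^ 2)) (𝓝[≠] (U e))) ^ 2 ∂μ else 0)) / β +
          ∫ U, (F U - F₁ U) ^ 2 ∂μ ≤
        C * ∫ U, (F U - condExp (cylinderEvents
            {e : Edge 4 (2 * S + 1) | ¬ ((e.1 0 - s).val = 0 ∧ e.2 ≠ 0)}) μ F U) ^ 2 ∂μ) →
    ∃ θ₁ : ℝ, 0 ≤ θ₁ ∧ θ₁ < 1 ∧ ∃ S₁ : ℕ, ∀ S : ℕ, S₁ ≤ S →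
      ∀ μ : Measure (GaugeConfig 4 (2 * S + 1) G),
        μ = (wilsonMeasure r.ρ β : Measure (GaugeConfig 4 (2 * S + 1) G)) →
      ∀ (s : ZMod (2 * S + 1)) (h : GaugeConfig 4 (2 * S + 1) G → ℝ), Measurable h →
        (∃ M : ℝ, ∀ U, |h U| ≤ M) → IsGaugeInvariant h →
        DependsOn h {e : Edge 4 (2 * S + 1) | ¬ ((e.1 0 - s).val = 0 ∧ e.2 ≠ 0)} →
      ∫ U, (condExp (cylinderEvents {e : Edge 4 (2 * S + 1) | (e.1 0 - s).val = 0 ∧ e.2 ≠ 0}) μ h U -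
          ∫ V, h V ∂μ) ^ 2 ∂μ ≤ θ₁ * ∫ U, (h U - ∫ V, h V ∂μ) ^ 2 ∂μ := by
  intro G _ _ _ _ _ _ r β hβ κ S₀ hP hSW0
  obtain ⟨C, _hC, S₁, hSW⟩ := hSW0
  set K : ℝ := max (2 * max (κ * β) 1 * C) 1 with hK
  have hK1 : 1 ≤ K := le_max_right _ _
  have hK0 : 0 < K := lt_of_lt_of_le one_pos hK1
  have hKle : 1 / K ≤ 1 := by
    rw [div_le_one hK0]
    exact hK1
  refine ⟨1 - 1 / K, by linarith, ?_, max S₀ S₁, fun S hS μ hμ s h hm hb hi hd => ?_⟩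
  · have : 0 < 1 / K := by positivity
    linarith
  · have hS₀ : S₀ ≤ S := le_trans (le_max_left _ _) hS
    have hS₁ : S₁ ≤ S := le_trans (le_max_right _ _) hS
    have hyps := stub_sliceHypothesis_timeShift G r β κ S (hP S hS₀) μ hμ s
    have hret := stub_retention_of_smoothWitness G r β κ C hβ S μ hμ s hyps (hSW S hS₁ μ hμ s)
    refine stub_oneSliceProjectionBound_of_retention G r β S μ hμ s (1 - 1 / K) (by linarith) ?_ h hm hb hi hd
    intro F hFm hFb hFi hFd
    have h1 := hret F hFm hFb hFi hFd
    have hR : 0 ≤ ∫ U, (F U - condExp (cylinderEvents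
        {e : Edge 4 (2 * S + 1) | ¬ ((e.1 0 - s).val = 0 ∧ e.2 ≠ 0)}) μ F U) ^ 2 ∂μ :=
      integral_nonneg fun _ => sq_nonneg _
    have hKK : 2 * max (κ * β) 1 * C ≤ K := le_max_left _ _
    have h2 : ∫ U, (F U - ∫ V, F V ∂μ) ^ 2 ∂μ ≤ K * ∫ U, (F U - condExp (cylinderEvents
        {e : Edge 4 (2 * S + 1) | ¬ ((e.1 0 - s).val = 0 ∧ e.2 ≠ 0)}) μ F U) ^ 2 ∂μ :=
      le_trans h1 (mul_le_mul_of_nonneg_right hKK hR)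
    have e1 : (1 - (1 - 1 / K)) = 1 / K := by ring
    rw [e1, one_div, inv_mul_le_iff₀ hK0]
    exact h2

end Summit.QuantumFields.YangMills.Theorems.PoincareToGap

end
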